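import Summits.BirchSwinnertonDyer.BirchSwinnertonDyer.Theorems.PrintX11aUpperNonSurjThreePrimaryLemmas
import HarnessLib

/-!
# Route `PrintX11a`, crux U3 `UpperNonSurjThree` (item stmt-BirchSwinnertonDyer-20613): U3 in the honest `3`-PRIMARY
# currency — `Ш(E)[3^∞]` finite, `rank E(ℚ) = 0` and `ord₃ #Ш(E)[3^∞] ≤ ord₃ #Ш(E)_an` at every non-surjective X11a pair at `3`,
# from the nine print-exact facts (no Gross–Zagier–Kolyvagin, no junk value of `#Ш`); lemmas in `PrintX11aUpperNonSurjThreePrimaryLemmas.lean`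

Cell `bsd-print-x11a`, width seat `bsd-line-x11a-p2` g4 of line «finemu3» (`--supports stmt-BirchSwinnertonDyer-20613 --as helper`).
Theorems only; Theses-free; CONDITIONAL on the named facts displayed as hypotheses; BSD is not proved by any of this; nothing is
asserted about any curve; item 20613 does not close by this file.

THE POINT (referee V49's typing note, 2026-08-28).  The typed conclusion of U3, `Typed.MissingUpperBoundAt W 3`, reads `#Ш` as
`W.shaOrder = Nat.card Ш(E/ℚ)`, which is the junk value `0` when `Ш` is infinite; the nine-fact road (g3,
`ClassX11a.upperNonSurjThree_body_of_nineFacts`) does not read Gross–Zagier–Kolyvagin, so inside its proof nothing knows that `Ш`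
is finite, and on an infinite `Ш` the typed inequality holds as `ord₃ 0 = 0 ≤ …`.  The MATHEMATICALLY MEANINGFUL content the same
proof produces is the `3`-primary statement, which needs no finiteness of `Ш` beyond `Ш[3^∞]` and which this file DISPLAYS class-wide:
at every X11a pair `(W, 3)` with `ρ̄_{E,3}` not surjective (`r_an = 0`, `3 ∥ N`, `E[3]` irreducible, images `3Ns ∕ 3Nn`),
* `rank E(ℚ) = 0` (Kato's divisibility + the tree's control theorem `mordellWeilRank_le_order_of_mem_charIdeal`),
* `Ш(E/ℚ)[3^∞]` is FINITE (Stein–Wuthrich 6.1 clause 2 at `ord_T f_E = 0 = rank`), and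
* `ord₃ #Ш(E/ℚ)[3^∞] ≤ ord₃ #Ш(E)_an`, `#Ш(E)_an = (L(E,1)/Ω_E) · #E(ℚ)² / ∏_ℓ c_ℓ` (Miller's rational number; `Reg = 1`),
granted the nine facts — Stein–Wuthrich 6.1 ×2, Greenberg–Stevens ∕ Kobayashi AT A SPLIT `3` ONLY, Kato 12.4, modularity, Kato
§17.13 V′ ∕ VI′ ∕ XI′ (contragredient packages), Mazur Cor. 4.1.  When `Ш(E/ℚ)` is finite this is literally `ord₃ #Ш ≤ ord₃ #Ш_an`
(`#Ш` and `#Ш[3^∞]` differ by a `3`-adic unit); when it is not, it is still the `3`-part of the BSD upper bound, not a junk `0 ≤ …`.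

HOW.  §1 re-runs g3's two rank-`0` leading-term lemmas (`X11b.le_padicValRat_of_{nonsplit,split}_divisibility_rankZero_noGZK`,
file `PrintX11aUpperNonSurjThreeRankZeroNoGZK.lean`) with the STRONGER conclusion `rank = 0 ∧ #Ш[p^∞] < ∞ ∧ (p-primary
inequality)` — same proof, last line through `padicValNat_card_primary_le_of_torsionSq_mul_eq` instead of the `shaOrder`
bookkeeping (the originals are append-only and do not export `#Ш[p^∞] < ∞`); §2 packages the inequality against Miller's `#Ш_an`
(`shaAn W`); §3 is the engine `X11b.MultDivisibilityAt W p ⟹ primary bound` at any odd multiplicative `p` with `r_an = 0`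
(p-generic: usable verbatim by U5 ∕ the K2 corner); §4 is the class-wide display at `p = 3` from the nine facts with
Greenberg–Stevens keyed at a split `3` ∕ at odd primes (the printed scope, cf. `upperNonSurjThree_of_nineFacts_oddGS`).
beyond-print theorem: no (the `μ₃` input is width seat g2's theorem `MultThreeMuAn.muAnZeroAt_three_of_mult_of_irr`, as before).

References (locators only): [cite: SteinWuthrich2013, Thm. 6.1 (p. 20), §4.2] [cite: BalakrishnanMullerStein2015, Thm. 1.7]
[cite: GreenbergLNM1716, Lemma 3.1, §4] [cite: Kobayashi2006DocMath, Cor. 4.2 (p. 575)] [cite: Miller2011LMS, Def. 1.1 and §1]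
[cite: Kato2004Asterisque, Thm. 12.4 (p. 221), §17.13 (pp. 279–280)] [cite: Mazur1978, Cor. 4.1]
[cite: MazurTateTeitelbaum1986Invent, §I.14–I.15]; tree `PrintX11aUpperNonSurjThree{RankZeroNoGZK,EngineWithoutGZK,Corollary18OfMazur}.lean`.
-/

set_option autoImplicit false

noncomputable section

open scoped Classical MatrixGroups ModularForm

open CongruenceSubgroup WeierstrassCurve
  Literature.NumberTheory.EllipticCurves
  Literature.NumberTheory.EllipticCurves.ModularForms
  Literature.NumberTheory.EllipticCurves.Rank1Residual
  Literature.NumberTheory.EllipticCurves.Rank1Residual.Typed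
  Literature.NumberTheory.EllipticCurves.Wuthrich2014
  Literature.NumberTheory.EllipticCurves.SteinWuthrich2013
  Literature.NumberTheory.EllipticCurves.Greenberg1999
  Literature.NumberTheory.EllipticCurves.Kato2004
  Summit.BirchSwinnertonDyer.Rank1Residual
  Summit.BirchSwinnertonDyer.Rank1Residual.RankZeroHeightFree
  Summit.BirchSwinnertonDyer.BirchSwinnertonDyer.Theorems

namespace Summit.BirchSwinnertonDyer.Rank1Residual.X11b

/-! ### §2 Packaging against Miller's `#Ш_an` -/

/-- **Packaging, `p`-primary**: if `L(E,1) ≠ 0`, `rank E(ℚ) = 0` and `L(E,1)/Ω_E = t` with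
`ord_p #Ш[p^∞] + ord_p ∏ c_ℓ − 2 ord_p #E(ℚ)_tors ≤ ord_p t`, then `ord_p #Ш[p^∞] ≤ ord_p #Ш_an` for Miller's rational
`#Ш_an = t · #E(ℚ)² / ∏ c_ℓ` (`r_an = 0`, `Reg = 1`, `E(ℚ) = E(ℚ)_tors` — tree theorems `regulator_eq_one_of_rank_zero`,
`finite_point_of_rank_zero`). The `#Ш[p^∞]`-twin of `missingUpperBoundAt_of_padicValRat_le_of_mordellWeilRank_eq_zero` (g3).
[cite: Miller2011LMS, Def. 1.1 and §1 (arXiv:1010.2431 p. 3)] -/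
theorem primaryBound_shaAn_of_padicValRat_le_of_mordellWeilRank_eq_zero
    (W : WeierstrassCurve ℚ) [W.IsElliptic] [W.IsGloballyMinimal] (p : ℕ) [Fact p.Prime]
    (hL : W.entireLFunction 1 ≠ 0) (hmw0 : W.mordellWeilRank = 0)
    (hq : ∃ q : ℚ, W.entireLFunction 1 / (W.realPeriodRat : ℂ) = (q : ℂ) ∧
      (padicValNat p (Nat.card (AddCommGroup.primaryComponent W.sha p)) : ℤ) + padicValNat p W.tamagawaProduct -
        2 * padicValNat p W.torsionOrder ≤ padicValRat p q) :
    ∃ q : ℚ, shaAn W = (q : ℂ) ∧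
      (padicValNat p (Nat.card (AddCommGroup.primaryComponent W.sha p)) : ℤ) ≤ padicValRat p q := by
  obtain ⟨q, hqL, hqv⟩ := hq
  haveI hE : Finite W.toAffine.Point := W.finite_point_of_rank_zero hmw0
  have hr0 : W.analyticRank = 0 := analyticRank_eq_zero_of_entireLFunction_one_ne_zero W hL
  have hΩC : (W.realPeriodRat : ℂ) ≠ 0 := Complex.ofReal_ne_zero.mpr W.realPeriodRat_pos_holds.ne'
  have hsha : shaAn W = ((q * (Nat.card W.toAffine.Point : ℚ) ^ 2 / (W.tamagawaProduct : ℚ) : ℚ) : ℂ) := by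
    have hLq : W.entireLFunction 1 = (q : ℂ) * (W.realPeriodRat : ℂ) := by
      rw [← hqL, div_mul_cancel₀ _ hΩC]
    rw [shaAn_def, W.leadingLCoeff_eq_of_analyticRank_eq_zero hr0, W.regulator_eq_one_of_rank_zero hmw0,
      W.torsionOrder_eq_natCard_of_finite, hLq]
    push_cast
    field_simp
  refine ⟨_, hsha, ?_⟩
  have hq0 : q ≠ 0 := by
    rintro rfl
    apply hL
    rw [← div_mul_cancel₀ (W.entireLFunction 1) hΩC, hqL]
    simp
  have hT : 0 < W.torsionOrder := W.torsionOrder_pos W.finite_torsion_holds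
  have hTc : (Nat.card W.toAffine.Point : ℚ) = (W.torsionOrder : ℚ) := by
    rw [W.torsionOrder_eq_natCard_of_finite]
  have hT0 : (Nat.card W.toAffine.Point : ℚ) ≠ 0 := by rw [hTc]; exact_mod_cast hT.ne'
  have hc0 : (W.tamagawaProduct : ℚ) ≠ 0 := by
    exact_mod_cast (W.tamagawaProduct_pos_holds : 0 < W.tamagawaProduct).ne'
  rw [padicValRat.div (mul_ne_zero hq0 (pow_ne_zero 2 hT0)) hc0,
    padicValRat.mul hq0 (pow_ne_zero 2 hT0), padicValRat.pow, hTc, padicValRat.of_nat,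
    padicValRat.of_nat]
  simp only [Nat.cast_ofNat]
  linarith

/-! ### §3 The rank-`0` engine in the `p`-primary currency (any odd multiplicative `p`) -/

/-- **The rank-`0` engine, `p`-primary currency, no Gross–Zagier–Kolyvagin**: for `W/ℚ` globally minimal, `p` an ODD
multiplicative prime with `ord_{s=1} L(E,s) = 0`, the typed divisibility `X11b.MultDivisibilityAt W p` gives `rank E(ℚ) = 0`,
`#Ш(E/ℚ)[p^∞] < ∞` and `ord_p #Ш(E/ℚ)[p^∞] ≤ ord_p #Ш(E)_an`, granted Stein–Wuthrich 6.1 (`hJs` ∕ `hJn`), modularity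
(`exists_isNewformOf`) and — ONLY at a split `p` — Greenberg–Stevens at the pair. The `#Ш[p^∞]`-twin of
`missingUpperBoundAt_of_multDivisibilityAt_of_analyticRank_eq_zero_noGZK` (g3), same proof; p-generic (U5 ∕ K2 corner may use it
verbatim). [cite: SteinWuthrich2013, Thm. 6.1 (p. 20) and §4.2] [cite: Kobayashi2006DocMath, Cor. 4.2 (p. 575)]
[cite: BalakrishnanMullerStein2015, Thm. 1.7] [cite: Miller2011LMS, Def. 1.1 and §1] -/
theorem primaryBound_of_multDivisibilityAt_of_analyticRank_eq_zero
    (hJs : thm61_splitMultiplicative) (hJn : thm61_nonsplitMultiplicative) (hnf : exists_isNewformOf)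
    (W : WeierstrassCurve ℚ) [W.IsElliptic] [W.IsGloballyMinimal] (p : ℕ) [Fact p.Prime]
    (hGS : W.HasSplitMultiplicativeReductionAtPrime p → greenberg_stevens (W := W) (p := p))
    (hp : p ≠ 2) (hmult : W.HasMultiplicativeReductionAtPrime p) (hr : W.analyticRank = 0)
    (hdiv : MultDivisibilityAt W p) :
    W.mordellWeilRank = 0 ∧ Finite (AddCommGroup.primaryComponent W.sha p) ∧
      ∃ q : ℚ, shaAn W = (q : ℂ) ∧
        (padicValNat p (Nat.card (AddCommGroup.primaryComponent W.sha p)) : ℤ) ≤ padicValRat p q := by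
  have hmod : hasEntireLFunction_rat := WeierstrassCurve.hasEntireLFunction_rat_of_exists_isNewformOf hnf
  have hpar : nonempty_modularParametrizationData :=
    nonempty_modularParametrizationData_of_modularity hnf IsNewformOf.exists_maninConstant_modularDegree_holds
  obtain ⟨κ, hκ, γ, hγ, hγ'⟩ := exists_isCyclotomic_isTopGenerator_isCyclotomicVariable_holds p
  obtain ⟨D⟩ := W.nonempty_selmerDualData_holds κ γ hγ
  haveI : NeZero (W.conductorNorm ℤ) := ⟨(W.conductorNorm_pos_holds).ne'⟩
  obtain ⟨Dm⟩ := hpar W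
  obtain ⟨ϖ, hϖpos, hϖ, -⟩ := Dm.exists_rat_mul_realPeriodRat_eq_plusPeriod
  obtain ⟨hX, hnsp, hsp⟩ := hdiv hκ hγ hγ' Dm.isNewformOf D ϖ hϖpos.ne' hϖ
  have hL1 : W.entireLFunction 1 ≠ 0 := (W.analyticRank_eq_zero_iff_holds (hmod W)).1 hr
  by_cases hsplit : W.HasSplitMultiplicativeReductionAtPrime p
  · obtain ⟨L, hL⟩ := exists_isSplitMultPAdicLFunctionOf hsplit Dm.isNewformOf
    obtain ⟨Dq⟩ := (nonempty_tateParameterData_iff_holds (W := W) (p := p)).mpr hsplit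
    obtain ⟨hr0, hfin, ht⟩ := primaryBound_of_split_divisibility_rankZero hJs W p (hGS hsplit)
      LInvariant_ne_zero_holds hp hL1 Dq hκ hγ hγ' Dm.isNewformOf D ϖ hϖpos.ne' hϖ L hL hX (hsp hsplit L hL)
    exact ⟨hr0, hfin, primaryBound_shaAn_of_padicValRat_le_of_mordellWeilRank_eq_zero W p hL1 hr0 ht⟩
  · obtain ⟨L, hL⟩ := exists_isMultPAdicLFunctionOf_neg_one_of_nonsplit Dm.isNewformOf hmult hsplit
    obtain ⟨q, ⟨hq0, hq1, hqj⟩, -⟩ := existsUnique_tateJ_eq_of_one_lt_norm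
      (one_lt_norm_j_of_hasMultiplicativeReductionAtPrime (W := W) (p := p) hmult)
    obtain ⟨hr0, hfin, ht⟩ := primaryBound_of_nonsplit_divisibility_rankZero hJn W p hp hL1 hmult hsplit hq0 hq1
      hqj hκ hγ hγ' Dm.isNewformOf D ϖ hϖpos.ne' hϖ L hL hX (hnsp hsplit L hL)
    exact ⟨hr0, hfin, primaryBound_shaAn_of_padicValRat_le_of_mordellWeilRank_eq_zero W p hL1 hr0 ht⟩

/-- **When `Ш(E/ℚ)` IS finite the primary bound is the typed one**: `ord_p #Ш = ord_p #Ш[p^∞]` (`Ш[p^∞]` is the Sylow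
`p`-subgroup), so the engine's conclusion gives `Typed.MissingUpperBoundAt W p` on the nose — the finite branch, displayed.
[cite: Miller2011LMS, Def. 1.1 and §1] -/
theorem missingUpperBoundAt_of_primaryBound_of_finite_sha
    (W : WeierstrassCurve ℚ) [W.IsElliptic] (p : ℕ) [Fact p.Prime] [Finite W.sha]
    (h : ∃ q : ℚ, shaAn W = (q : ℂ) ∧
      (padicValNat p (Nat.card (AddCommGroup.primaryComponent W.sha p)) : ℤ) ≤ padicValRat p q) :
    Typed.MissingUpperBoundAt W p := by
  obtain ⟨q, hq, hv⟩ := h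
  obtain ⟨m, hm, hcard⟩ := exists_card_eq_card_primaryComponent_mul_not_dvd W.sha p
  refine ⟨q, hq, ?_⟩
  have hA : Nat.card (AddCommGroup.primaryComponent W.sha p) ≠ 0 := Nat.card_pos.ne'
  have hm0 : m ≠ 0 := by
    rintro rfl
    exact hm (dvd_zero p)
  rwa [WeierstrassCurve.shaOrder, hcard, padicValNat.mul hA hm0, padicValNat.eq_zero_of_not_dvd hm, add_zero]

end Summit.BirchSwinnertonDyer.Rank1Residual.X11b

/-! ### §4 The class-wide display at `p = 3` from the nine print-exact facts -/

namespace Summit.BirchSwinnertonDyer.Rank1Residual.ClassX11a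

/-- **U3 per pair in the `3`-primary currency, from EIGHT named facts plus Greenberg–Stevens at the pair (only if `3` is split).**
At an X11a pair `(W, 3)` with `ρ̄_{E,3}` not surjective: `rank E(ℚ) = 0`, `Ш(E/ℚ)[3^∞]` is finite and
`ord₃ #Ш(E/ℚ)[3^∞] ≤ ord₃ #Ш(E)_an`. The divisibility at `3` is `X11b.multDivisibilityAt_three_of_not_surj_of_sixFacts`
(μ-road: g2's `μ₃ = 0` theorem ⟹ XI′ transfer ⟹ Kato 12.4 + V′ ∕ VI′, Mazur for `ϖ`); the engine is §3.
[cite: Kato2004Asterisque, Thm. 12.4 (p. 221), §17.13 (pp. 279–280)] [cite: SteinWuthrich2013, Thm. 6.1 (p. 20)]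
[cite: Mazur1978, Cor. 4.1] [cite: Kobayashi2006DocMath, Cor. 4.2 (p. 575)] -/
theorem primaryUpperBound_three_of_not_surj_of_nineFacts
    (hJs : thm61_splitMultiplicative) (hJn : thm61_nonsplitMultiplicative)
    (h12 : Kato2004.thm12_4) (hnf : exists_isNewformOf)
    (hns' : Kato2004.exists_multDivisibilityInputs_nonsplit_contra)
    (hsp' : Kato2004.exists_multDivisibilityInputs_split_contra)
    (hfine' : Kato2004.exists_multDivisibilityInputs_fine_contra) (hMz : mazur_not_dvd_maninConstant_of_odd)
    (W : WeierstrassCurve ℚ) [W.IsElliptic] [W.IsGloballyMinimal] [Fact (Nat.Prime 3)]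
    (hGS : W.HasSplitMultiplicativeReductionAtPrime 3 → greenberg_stevens (W := W) (p := 3))
    (hX : ClassX11a W 3) (hns : ¬ Surj W 3) :
    W.mordellWeilRank = 0 ∧ Finite (AddCommGroup.primaryComponent W.sha 3) ∧
      ∃ q : ℚ, shaAn W = (q : ℂ) ∧
        (padicValNat 3 (Nat.card (AddCommGroup.primaryComponent W.sha 3)) : ℤ) ≤ padicValRat 3 q :=
  X11b.primaryBound_of_multDivisibilityAt_of_analyticRank_eq_zero hJs hJn hnf W 3 hGS hX.2.1 hX.2.2.1 hX.1
    (X11b.multDivisibilityAt_three_of_not_surj_of_sixFacts h12 hnf hns' hsp' hfine' hMz W hX.2.2.1 hX.2.2.2.1 hns)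

/-- **U3 in the `3`-primary currency, class-wide, from the NINE print-exact facts with Greenberg–Stevens keyed at ODD primes**
(Kobayashi 2006 Cor. 4.2's printed scope): at every X11a pair `(W, p)` with `ρ̄_{E,p}` not surjective and `p = 3`,
`rank E(ℚ) = 0 ∧ #Ш(E/ℚ)[p^∞] < ∞ ∧ ord_p #Ш(E/ℚ)[p^∞] ≤ ord_p #Ш(E)_an`. CONDITIONAL on the nine displayed facts; the
junk-free companion of `upperNonSurjThree_body_of_nineFacts` ∕ `Theorems.upperNonSurjThree_of_nineFacts_oddGS`.
[cite: SteinWuthrich2013, Thm. 6.1 (p. 20)] [cite: Kobayashi2006DocMath, Cor. 4.2 (p. 575)]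
[cite: Kato2004Asterisque, Thm. 12.4 (p. 221) and §17.13 (pp. 279–280)] [cite: Mazur1978, Cor. 4.1]
[cite: GreenbergLNM1716, §1 Conj. 1.11 (p. 58)] [cite: Miller2011LMS, Def. 1.1 and §1] -/
theorem upperNonSurjThree_primary_of_nineFacts_oddGS
    (hJs : thm61_splitMultiplicative) (hJn : thm61_nonsplitMultiplicative)
    (hGS : ∀ (W : WeierstrassCurve ℚ) [W.IsElliptic] [W.IsGloballyMinimal] (p : ℕ) [Fact p.Prime],
      p ≠ 2 → greenberg_stevens (W := W) (p := p))
    (h12 : Kato2004.thm12_4) (hnf : exists_isNewformOf)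
    (hns' : Kato2004.exists_multDivisibilityInputs_nonsplit_contra)
    (hsp' : Kato2004.exists_multDivisibilityInputs_split_contra)
    (hfine' : Kato2004.exists_multDivisibilityInputs_fine_contra) (hMz : mazur_not_dvd_maninConstant_of_odd) :
    ∀ (W : WeierstrassCurve ℚ) [W.IsElliptic] [W.IsGloballyMinimal] (p : ℕ) [Fact p.Prime],
      ClassX11a W p → ¬ Surj W p → p = 3 →
        W.mordellWeilRank = 0 ∧ Finite (AddCommGroup.primaryComponent W.sha p) ∧
          ∃ q : ℚ, shaAn W = (q : ℂ) ∧
            (padicValNat p (Nat.card (AddCommGroup.primaryComponent W.sha p)) : ℤ) ≤ padicValRat p q := by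
  intro W _ _ p _ hX hns hp3
  subst hp3
  exact primaryUpperBound_three_of_not_surj_of_nineFacts hJs hJn h12 hnf hns' hsp' hfine' hMz W
    (fun _ => hGS W 3 (by decide)) hX hns

/-- **The same with the r5 stub's shape of the GS conjunct** (`∀ W p, greenberg_stevens`, as in `stub_nineFactsAn` and in
conjunct 14 of item 19949): projection to the odd-keyed form. [cite: Kobayashi2006DocMath, Cor. 4.2 (p. 575)] -/
theorem upperNonSurjThree_primary_of_nineFacts
    (hJs : thm61_splitMultiplicative) (hJn : thm61_nonsplitMultiplicative)
    (hGS : ∀ (W : WeierstrassCurve ℚ) [W.IsElliptic] [W.IsGloballyMinimal] (p : ℕ) [Fact p.Prime],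
      greenberg_stevens (W := W) (p := p))
    (h12 : Kato2004.thm12_4) (hnf : exists_isNewformOf)
    (hns' : Kato2004.exists_multDivisibilityInputs_nonsplit_contra)
    (hsp' : Kato2004.exists_multDivisibilityInputs_split_contra)
    (hfine' : Kato2004.exists_multDivisibilityInputs_fine_contra) (hMz : mazur_not_dvd_maninConstant_of_odd) :
    ∀ (W : WeierstrassCurve ℚ) [W.IsElliptic] [W.IsGloballyMinimal] (p : ℕ) [Fact p.Prime],
      ClassX11a W p → ¬ Surj W p → p = 3 →
        W.mordellWeilRank = 0 ∧ Finite (AddCommGroup.primaryComponent W.sha p) ∧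
          ∃ q : ℚ, shaAn W = (q : ℂ) ∧
            (padicValNat p (Nat.card (AddCommGroup.primaryComponent W.sha p)) : ℤ) ≤ padicValRat p q :=
  upperNonSurjThree_primary_of_nineFacts_oddGS hJs hJn (fun W _ _ p _ _ ↦ hGS W p) h12 hnf hns' hsp' hfine' hMz

end Summit.BirchSwinnertonDyer.Rank1Residual.ClassX11a

end
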